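import Summits.BirchSwinnertonDyer.BirchSwinnertonDyer.Theorems.CyclotomicUntwistPadicRankTwoAssembly
import Summits.BirchSwinnertonDyer.BirchSwinnertonDyer.Theorems.CyclotomicUntwistNineGoodModelTransportCalculus
import Literature.NumberTheory.EllipticCurves.FormalGroupMultiplication
import Literature.NumberTheory.EllipticCurves.FormalMulTwoLowOrderProofs
import HarnessLib

/-!
# The BRIDGE «finite-level digits + 3-adic limits ⟹ rank 2 over ℤ_p»: from Honda's `pᵏg = log(h)` and the digit
# expansion `h̄ = [a_J] ⊕ [b_J]π ⊕ [pᴶ]g_J` of the endomorphism `h̄` (numbers `a_J → A`, `b_J → B`) to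
# `pᵏg − A·log − B·log(Xᵖ) ∈ ℤ_p⟦X⟧` — the `H3ss` binder of the `CyclotomicUntwist` Katz-rank programme, per curve

Cell `pub/bsd-wall` (D-0145 line `route-BirchSwinnertonDyer-CyclotomicUntwist`), width seat `bsd-line-cycu-p4` (gen 8); the
«p4: BRIDGE» asked by the lead cycu-p1 g6 (INBOX 13:55Z) between cycu-p2 g7's finite-level digit theorem ★ (W3-core) and
the lead's assembly `CyclotomicUntwistPadicRankTwoAssembly` (p638957, binders `hW1` = cycu-p3's Honda step, `hW3`). THEOREMS
ONLY (no definition, no named fact, no `sorry`); helper `--supports` K1 = stmt-BirchSwinnertonDyer-21580 (stub `S2k` via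
`KatzRankBaseChange.stub_KATZ_rankLeTwo_supersingular_of_padicRankTwo`). BSD is not proved by this file and no crux / stub is.

* §1 PURE ANALYSIS **`isPadicInt_sub_of_digits`** — for a log-type `ℓ ∈ Xℚ_p⟦X⟧` (`‖n·ℓₙ‖ ≤ 1`), a series `Φ`, numbers
  `a_J → A`, `b_J → B` (`‖a_J − A‖ ≤ p^{−J}`) and, at every level `J`, an integral `G_J ∈ Xℚ_p⟦X⟧` with
  `Φ − a_J·ℓ − b_J·ℓ(Xᵖ) − pᴶ·ℓ(G_J) ∈ ℤ_p⟦X⟧`: then `Φ − A·ℓ − B·ℓ(Xᵖ) ∈ ℤ_p⟦X⟧` (coefficient `n` at level `J = n`: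
  `‖[Xⁿ]ℓ(G)‖ ≤ pⁿ`, `‖ℓₙ‖ ≤ pⁿ`);
* §2 `formalLog_subst_level` — `log F(F([a]X, [b](Xᵖ)), [N](G)) = a·log + b·log(Xᵖ) + N·log(G)`; `map_level` (the level
  composite commutes with ring maps);
* §3 **`padicRankTwo_of_honda_of_digits (hp2) (hW1) (hDig)`** — the body of `H3ss` for one `V/ℤ_p` with elliptic fibres:
  every second-kind `g` is `≡ a·log + b·log(Xᵖ)` modulo `p`-power-bounded denominators, GRANTED Honda's step `hW1`
  (`pᵏg = log h`, cycu-p3) and the digit theorem `hDig` (cycu-p2 g7's ★ with its `ℤ_p`-limits, read for the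
  endomorphism `h̄`, which IS one by the lead's `map_toZMod_subst_formalGroupLaw` over Lemma Λ).

References: N. M. Katz, LNM 868 (1981) §5, Thm 5.3.3 [Katz1981CrystallineDieudonne]; T. Honda, J. Math. Soc. Japan 22 (1970)
Thm. 2 [Honda1970]; M. Hazewinkel, *Formal Groups and Applications* (1978) I §2.3 [Hazewinkel1978].
-/

set_option autoImplicit false
-- single-conjunct summit: `Summit.BirchSwinnertonDyer.BirchSwinnertonDyer.…` repeats the name by design
set_option linter.dupNamespace false

noncomputable section

open scoped Classical
open PowerSeries WeierstrassCurve Literature.NumberTheory.EllipticCurves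
  Summit.BirchSwinnertonDyer.BirchSwinnertonDyer.Theorems.PadicRankTwoAssembly

namespace Summit.BirchSwinnertonDyer.BirchSwinnertonDyer.Theorems.PadicDigitLimit

variable {p : ℕ} [hp : Fact p.Prime]

/-! ### §1 Pure analysis: the limit of the digit approximations -/

/-- `‖ℓₙ‖ ≤ pⁿ` for a log-type series without constant term (`‖n·ℓₙ‖ ≤ 1`, `v_p(n) < n`). [folklore] -/
theorem norm_coeff_le_pow {ℓ : ℚ_[p]⟦X⟧} (hℓ : ∀ n : ℕ, ‖(n : ℚ_[p]) * coeff n ℓ‖ ≤ 1)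
    (hℓ0 : constantCoeff ℓ = 0) (n : ℕ) : ‖coeff n ℓ‖ ≤ (p : ℝ) ^ n := by
  have hp1 : (1 : ℝ) < p := by exact_mod_cast hp.out.one_lt
  rcases Nat.eq_zero_or_pos n with rfl | hn
  · rw [coeff_zero_eq_constantCoeff, hℓ0, norm_zero, pow_zero]; exact zero_le_one
  · have hn0 : ((n : ℕ) : ℚ_[p]) ≠ 0 := by exact_mod_cast hn.ne'
    have hv : padicValNat p n < n := by
      have h1 := Nat.le_of_dvd hn (pow_padicValNat_dvd (p := p) (n := n))
      have h2 := Nat.lt_pow_self hp.out.one_lt (n := padicValNat p n)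
      omega
    have hnorm : ‖(n : ℚ_[p])‖ = (p : ℝ) ^ (-(padicValNat p n : ℤ)) := by
      rw [Padic.norm_eq_zpow_neg_valuation hn0, Padic.valuation_natCast]
    have hpos : 0 < ‖(n : ℚ_[p])‖ := norm_pos_iff.mpr hn0
    have key := hℓ n
    rw [norm_mul, mul_comm] at key
    rw [← le_div_iff₀ hpos] at key
    refine key.trans ?_
    rw [hnorm, one_div, ← zpow_neg, neg_neg, zpow_natCast]
    exact pow_le_pow_right₀ hp1.le hv.le

/-- `‖[Xⁿ] ℓ(G)‖ ≤ pⁿ` for log-type `ℓ` without constant term and integral `G` without constant term. [folklore] -/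
theorem norm_coeff_subst_le_pow {ℓ : ℚ_[p]⟦X⟧} (hℓ : ∀ n : ℕ, ‖(n : ℚ_[p]) * coeff n ℓ‖ ≤ 1)
    (hℓ0 : constantCoeff ℓ = 0) {G : ℚ_[p]⟦X⟧} (hG : IsPadicInt G) (hG0 : constantCoeff G = 0) (n : ℕ) :
    ‖coeff n (ℓ.subst G)‖ ≤ (p : ℝ) ^ n := by
  have hp1 : (1 : ℝ) < p := by exact_mod_cast hp.out.one_lt
  rw [coeff_subst_eq_sum_range' ℓ hG0 n]
  refine IsUltrametricDist.norm_sum_le_of_forall_le_of_nonneg (by positivity) fun m hm ↦ ?_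
  rw [Finset.mem_range] at hm
  rw [norm_mul]
  calc ‖coeff m ℓ‖ * ‖coeff n (G ^ m)‖ ≤ (p : ℝ) ^ m * 1 :=
        mul_le_mul (norm_coeff_le_pow hℓ hℓ0 m) (isPadicInt_iff_coeff.mp (hG.pow m) n) (norm_nonneg _) (by positivity)
    _ ≤ (p : ℝ) ^ n := by rw [mul_one]; exact pow_le_pow_right₀ hp1.le (by omega)

/-- `‖[Xⁿ] ℓ(Xᵖ)‖ ≤ pⁿ` for log-type `ℓ` without constant term. [folklore] -/
theorem norm_coeff_expand_le_pow {ℓ : ℚ_[p]⟦X⟧} (hℓ : ∀ n : ℕ, ‖(n : ℚ_[p]) * coeff n ℓ‖ ≤ 1)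
    (hℓ0 : constantCoeff ℓ = 0) (n : ℕ) : ‖coeff n (expand p hp.out.ne_zero ℓ)‖ ≤ (p : ℝ) ^ n := by
  have hp1 : (1 : ℝ) < p := by exact_mod_cast hp.out.one_lt
  rw [coeff_expand]
  split_ifs with h
  · exact (norm_coeff_le_pow hℓ hℓ0 _).trans (pow_le_pow_right₀ hp1.le (Nat.div_le_self n p))
  · rw [norm_zero]; positivity

/-- **THE LIMIT OF THE DIGIT APPROXIMATIONS (pure `p`-adic analysis).** Let `ℓ ∈ Xℚ_p⟦X⟧` be log-type
(`‖n·ℓₙ‖ ≤ 1`), `Φ ∈ ℚ_p⟦X⟧`, and `a_J → A`, `b_J → B` in `ℚ_p` with `‖a_J − A‖, ‖b_J − B‖ ≤ p^{−J}`. If at every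
level `J` there is an integral `G_J ∈ Xℚ_p⟦X⟧` with `Φ − a_J·ℓ − b_J·ℓ(Xᵖ) − pᴶ·ℓ(G_J) ∈ ℤ_p⟦X⟧`, then
`Φ − A·ℓ − B·ℓ(Xᵖ) ∈ ℤ_p⟦X⟧`: at the coefficient of `Xⁿ` use level `J = n`, where `‖pᴶ[Xⁿ]ℓ(G_J)‖ ≤ p^{n−J}` and
`‖(a_J − A)ℓₙ‖ ≤ p^{n−J}`. [cite: Katz1981CrystallineDieudonne, Thm. 5.3.3] -/
theorem isPadicInt_sub_of_digits {ℓ : ℚ_[p]⟦X⟧} (hℓ : ∀ n : ℕ, ‖(n : ℚ_[p]) * coeff n ℓ‖ ≤ 1)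
    (hℓ0 : constantCoeff ℓ = 0) {Φ : ℚ_[p]⟦X⟧} {a b : ℕ → ℚ_[p]} {A B : ℚ_[p]}
    (hA : ∀ J : ℕ, ‖a J - A‖ ≤ (p : ℝ) ^ (-(J : ℤ))) (hB : ∀ J : ℕ, ‖b J - B‖ ≤ (p : ℝ) ^ (-(J : ℤ)))
    (hJ : ∀ J : ℕ, ∃ G : ℚ_[p]⟦X⟧, IsPadicInt G ∧ constantCoeff G = 0 ∧
      IsPadicInt (Φ - C (a J) * ℓ - C (b J) * expand p hp.out.ne_zero ℓ - C ((p : ℚ_[p]) ^ J) * ℓ.subst G)) :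
    IsPadicInt (Φ - C A * ℓ - C B * expand p hp.out.ne_zero ℓ) := by
  have hp1 : (1 : ℝ) < p := by exact_mod_cast hp.out.one_lt
  have hp0 : (0 : ℝ) < p := by positivity
  rw [isPadicInt_iff_coeff]
  intro n
  obtain ⟨G, hG, hG0, hR⟩ := hJ n
  have hRn := isPadicInt_iff_coeff.mp hR n
  -- decomposition of the coefficient
  have e : coeff n (Φ - C A * ℓ - C B * expand p hp.out.ne_zero ℓ) =
      coeff n (Φ - C (a n) * ℓ - C (b n) * expand p hp.out.ne_zero ℓ - C ((p : ℚ_[p]) ^ n) * ℓ.subst G) +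
        ((p : ℚ_[p]) ^ n * coeff n (ℓ.subst G) +
          ((a n - A) * coeff n ℓ + (b n - B) * coeff n (expand p hp.out.ne_zero ℓ))) := by
    simp only [map_sub, coeff_C_mul]; ring
  rw [e]
  have hpn : ‖(p : ℚ_[p]) ^ n‖ = (p : ℝ) ^ (-(n : ℤ)) := Padic.norm_p_pow n
  have hcancel : (p : ℝ) ^ (-(n : ℤ)) * (p : ℝ) ^ n = 1 := by
    rw [zpow_neg, zpow_natCast, inv_mul_cancel₀ (by positivity)]
  have h2 : ‖(p : ℚ_[p]) ^ n * coeff n (ℓ.subst G)‖ ≤ 1 := by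
    rw [norm_mul, hpn]
    calc (p : ℝ) ^ (-(n : ℤ)) * ‖coeff n (ℓ.subst G)‖ ≤ (p : ℝ) ^ (-(n : ℤ)) * (p : ℝ) ^ n := by
          gcongr; exact norm_coeff_subst_le_pow hℓ hℓ0 hG hG0 n
      _ = 1 := hcancel
  have h3 : ‖(a n - A) * coeff n ℓ‖ ≤ 1 := by
    rw [norm_mul]
    calc ‖a n - A‖ * ‖coeff n ℓ‖ ≤ (p : ℝ) ^ (-(n : ℤ)) * (p : ℝ) ^ n :=
          mul_le_mul (hA n) (norm_coeff_le_pow hℓ hℓ0 n) (norm_nonneg _) (by positivity)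
      _ = 1 := hcancel
  have h4 : ‖(b n - B) * coeff n (expand p hp.out.ne_zero ℓ)‖ ≤ 1 := by
    rw [norm_mul]
    calc ‖b n - B‖ * ‖coeff n (expand p hp.out.ne_zero ℓ)‖ ≤ (p : ℝ) ^ (-(n : ℤ)) * (p : ℝ) ^ n :=
          mul_le_mul (hB n) (norm_coeff_expand_le_pow hℓ hℓ0 n) (norm_nonneg _) (by positivity)
      _ = 1 := hcancel
  refine (IsUltrametricDist.norm_add_le_max _ _).trans (max_le hRn ?_)
  refine (IsUltrametricDist.norm_add_le_max _ _).trans (max_le h2 ?_)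
  exact (IsUltrametricDist.norm_add_le_max _ _).trans (max_le h3 h4)

/-! ### §2 The level-`J` composite `F(F([a]X, [b](Xᵖ)), [N](G))`: its logarithm and its base change -/

section Level

variable {R : Type*} [CommRing R] (U : WeierstrassCurve R)

/-- The inner pair `F([a]X, [b](Xᵖ))` has no constant term. [folklore] -/
theorem constantCoeff_inner (a b : ℕ) :
    constantCoeff (MvPowerSeries.subst ![U.formalMul a, expand p hp.out.ne_zero (U.formalMul b)] U.formalGroupLaw :
      R⟦X⟧) = 0 := by
  have ha : constantCoeff (U.formalMul a) = 0 := U.constantCoeff_formalMul a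
  have hb : constantCoeff (expand p hp.out.ne_zero (U.formalMul b)) = 0 := by
    rw [constantCoeff_expand]; exact U.constantCoeff_formalMul b
  exact MvPowerSeries.constantCoeff_subst_eq_zero (hasSubst_pair ha hb) (constantCoeff_pair ha hb)
    U.constantCoeff_formalGroupLaw

/-- `[N](G)` has no constant term when `G` has none. [folklore] -/
theorem constantCoeff_formalMul_subst (N : ℕ) {G : R⟦X⟧} (hG0 : constantCoeff G = 0) :
    constantCoeff ((U.formalMul N).subst G) = 0 :=
  constantCoeff_powerSeries_subst_eq_zero hG0 (U.constantCoeff_formalMul N)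

/-- **The level composite commutes with ring maps.** [folklore] -/
theorem map_level {S : Type*} [CommRing S] (φ : R →+* S) (a b N : ℕ) {G : R⟦X⟧} (hG0 : constantCoeff G = 0) :
    PowerSeries.map φ (MvPowerSeries.subst ![MvPowerSeries.subst ![U.formalMul a, expand p hp.out.ne_zero (U.formalMul b)]
        U.formalGroupLaw, (U.formalMul N).subst G] U.formalGroupLaw : R⟦X⟧) =
      MvPowerSeries.subst ![MvPowerSeries.subst ![(U.map φ).formalMul a,
          expand p hp.out.ne_zero ((U.map φ).formalMul b)] (U.map φ).formalGroupLaw,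
        ((U.map φ).formalMul N).subst (G.map φ)] (U.map φ).formalGroupLaw := by
  have ha : constantCoeff (U.formalMul a) = 0 := U.constantCoeff_formalMul a
  have hb : constantCoeff (expand p hp.out.ne_zero (U.formalMul b)) = 0 := by
    rw [constantCoeff_expand]; exact U.constantCoeff_formalMul b
  have hm : PowerSeries.map φ ((U.formalMul N).subst G) = ((U.formalMul N).map φ).subst (G.map φ) := by
    change MvPowerSeries.map φ ((U.formalMul N).subst G) = _
    rw [PowerSeries.map_subst (HasSubst.of_constantCoeff_zero' hG0)]
    rfl
  rw [U.map_subst_pair_formalGroupLaw_powerSeries φ (constantCoeff_inner U a b) (constantCoeff_formalMul_subst U N hG0),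
    U.map_subst_pair_formalGroupLaw_powerSeries φ ha hb, PowerSeries.map_expand, U.map_formalMul, U.map_formalMul, hm,
    U.map_formalMul]

end Level

section LevelLog

variable (W : WeierstrassCurve ℚ_[p]) [hW : W.IsIntegral ℤ_[p]]

/-- **`log_W F(F([a]X, [b](Xᵖ)), [N](G)) = a·log_W + b·log_W(Xᵖ) + N·log_W(G)`** (`log_W` is a homomorphism to `𝔾_a`,
`log_W ∘ [n] = n·log_W`). [cite: SilvermanAEC2009, IV.5.2 and IV.2.3] -/
theorem formalLog_subst_level (a b N : ℕ) {G : ℚ_[p]⟦X⟧} (hG0 : constantCoeff G = 0) :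
    W.formalLog.subst (MvPowerSeries.subst ![MvPowerSeries.subst ![W.formalMul a, expand p hp.out.ne_zero (W.formalMul b)]
        W.formalGroupLaw, (W.formalMul N).subst G] W.formalGroupLaw : ℚ_[p]⟦X⟧) =
      C (a : ℚ_[p]) * W.formalLog + C (b : ℚ_[p]) * expand p hp.out.ne_zero W.formalLog + C (N : ℚ_[p]) * W.formalLog.subst G := by
  have ha : constantCoeff (W.formalMul a) = 0 := W.constantCoeff_formalMul a
  have hb0 : constantCoeff (W.formalMul b) = 0 := W.constantCoeff_formalMul b
  have hb : constantCoeff (expand p hp.out.ne_zero (W.formalMul b)) = 0 := by rw [constantCoeff_expand]; exact hb0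
  have hN : constantCoeff (W.formalMul N) = 0 := W.constantCoeff_formalMul N
  have hGs : HasSubst G := HasSubst.of_constantCoeff_zero' hG0
  rw [formalLog_subst_pair W (constantCoeff_inner W a b) (constantCoeff_formalMul_subst W N hG0)]
  change W.formalLog.subst (MvPowerSeries.subst ![W.formalMul a, expand p hp.out.ne_zero (W.formalMul b)] W.formalGroupLaw) +
    W.formalLog.subst ((W.formalMul N).subst G) = _
  rw [formalLog_subst_pair W ha hb]
  rw [← NineGoodModelTransportCalculus.expand_subst_eq_subst_expand hb0, W.formalLog_subst_formalMul,
    W.formalLog_subst_formalMul, ← subst_comp_subst_apply (HasSubst.of_constantCoeff_zero' hN) hGs,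
    W.formalLog_subst_formalMul, nsmul_eq_mul, nsmul_eq_mul, nsmul_eq_mul, subst_mul hGs,
    ← map_natCast (C (R := ℚ_[p])) a, ← map_natCast (C (R := ℚ_[p])) b, ← map_natCast (C (R := ℚ_[p])) N, map_mul,
    expand_C, subst_C]
  rfl

end LevelLog

/-! ### §3 The bridge: Honda step + digit theorem ⟹ rank `≤ 2` over `ℤ_p` -/

section Bridge

variable (V : WeierstrassCurve ℤ_[p]) [hE : (V.map PadicInt.Coe.ringHom).IsElliptic]
  [hEt : (V.map PadicInt.toZMod).IsElliptic]

/-- A series over `𝔽_p` without constant term lifts to an integral series over `ℤ_p` without constant term. [folklore] -/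
theorem exists_lift_eq (g : (ZMod p)⟦X⟧) (hg : constantCoeff g = 0) :
    ∃ G : ℤ_[p]⟦X⟧, constantCoeff G = 0 ∧ G.map PadicInt.toZMod = g := by
  have hs := ZMod.ringHom_surjective (PadicInt.toZMod (p := p))
  choose f hf using hs
  refine ⟨PowerSeries.mk fun n => if n = 0 then 0 else f (coeff n g), ?_, ?_⟩
  · rw [← coeff_zero_eq_constantCoeff, coeff_mk, if_pos rfl]
  · ext n
    rw [coeff_map, coeff_mk]
    split_ifs with h
    · rw [h, map_zero, coeff_zero_eq_constantCoeff, hg]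
    · exact hf _

/-- **RANK `≤ 2` OVER `ℤ_p` FROM HONDA'S STEP AND THE DIGIT THEOREM** (the body of the binder `H3ss`, per curve). For
`V/ℤ_p` (`p` odd) with elliptic generic and special fibres, GRANTED (W1) *Honda*: every second-kind `g` has `pᵏg = log_W h`,
`h ∈ Xℤ_p⟦X⟧`, and (★) *digits*: every `H ∈ Xℤ_p⟦X⟧` whose reduction is an endomorphism of the reduced formal group admits,
at every level `J`, natural numbers `a_J, b_J` and `g_J ∈ X𝔽_p⟦X⟧` with `H̄ = F̄(F̄([a_J]X, [b_J](Xᵖ)), [pᴶ](g_J))`,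
the digits converging to `A, B ∈ ℤ_p` (`‖a_J − A‖, ‖b_J − B‖ ≤ p^{−J}`) — THEN every second-kind `g` satisfies
`g ≡ a·log_W + b·log_W(Xᵖ)` modulo `p`-power-bounded denominators. Proof: `h̄ ∈ End(F̄)` (lead's B1 over Lemma Λ); lift
`g_J`, so `h ≡ F(F([a_J]X,[b_J](Xᵖ)),[pᴶ](G_J)) (mod p)`, hence `pᵏg = log h ≡ a_J log + b_J log(Xᵖ) + pᴶ log(G_J)
(mod pℤ_p⟦X⟧)` (Key Lemma over `ℤ_p`, `formalLog_subst_level`); pass to the limit (`isPadicInt_sub_of_digits`); divide by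
`pᵏ`. [cite: Katz1981CrystallineDieudonne, Thm. 5.3.3] [cite: Honda1970, Thm. 2] -/
theorem padicRankTwo_of_honda_of_digits (hp2 : p ≠ 2)
    (hW1 : ∀ g : ℚ_[p]⟦X⟧, constantCoeff g = 0 →
      (∃ d : ℕ, ∀ n : ℕ, ‖(p : ℚ_[p]) ^ d * ((n : ℚ_[p]) * coeff n g)‖ ≤ 1) →
      (∃ d' : ℕ, ∀ e : Fin 2 →₀ ℕ, ‖(p : ℚ_[p]) ^ d' * MvPowerSeries.coeff e
        (g.subst (V.map PadicInt.Coe.ringHom).formalGroupLaw - g.subst (MvPowerSeries.X 0) -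
          g.subst (MvPowerSeries.X 1))‖ ≤ 1) →
      ∃ (k : ℕ) (h : ℚ_[p]⟦X⟧), constantCoeff h = 0 ∧ IsPadicInt h ∧
        (V.map PadicInt.Coe.ringHom).formalLog.subst h = C ((p : ℚ_[p]) ^ k) * g)
    (hDig : ∀ H : ℤ_[p]⟦X⟧, constantCoeff H = 0 →
      (H.map PadicInt.toZMod).subst (V.map PadicInt.toZMod).formalGroupLaw =
        MvPowerSeries.subst ![(H.map PadicInt.toZMod).subst (MvPowerSeries.X 0 : MvPowerSeries (Fin 2) (ZMod p)),
          (H.map PadicInt.toZMod).subst (MvPowerSeries.X 1 : MvPowerSeries (Fin 2) (ZMod p))]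
          (V.map PadicInt.toZMod).formalGroupLaw →
      ∃ (A B : ℤ_[p]) (a b : ℕ → ℕ) (g : ℕ → (ZMod p)⟦X⟧),
        (∀ J, constantCoeff (g J) = 0) ∧
        (∀ J, ‖((a J : ℤ_[p]) - A : ℤ_[p])‖ ≤ (p : ℝ) ^ (-(J : ℤ)) ∧ ‖((b J : ℤ_[p]) - B : ℤ_[p])‖ ≤ (p : ℝ) ^ (-(J : ℤ))) ∧
        ∀ J, H.map PadicInt.toZMod =
          MvPowerSeries.subst ![MvPowerSeries.subst ![(V.map PadicInt.toZMod).formalMul (a J),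
              expand p hp.out.ne_zero ((V.map PadicInt.toZMod).formalMul (b J))] (V.map PadicInt.toZMod).formalGroupLaw,
            ((V.map PadicInt.toZMod).formalMul (p ^ J)).subst (g J)] (V.map PadicInt.toZMod).formalGroupLaw) :
    ∀ g : ℚ_[p]⟦X⟧, constantCoeff g = 0 →
      (∃ d : ℕ, ∀ n : ℕ, ‖(p : ℚ_[p]) ^ d * ((n : ℚ_[p]) * coeff n g)‖ ≤ 1) →
      (∃ d' : ℕ, ∀ e : Fin 2 →₀ ℕ, ‖(p : ℚ_[p]) ^ d' * MvPowerSeries.coeff e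
        (g.subst (V.map PadicInt.Coe.ringHom).formalGroupLaw - g.subst (MvPowerSeries.X 0) -
          g.subst (MvPowerSeries.X 1))‖ ≤ 1) →
      ∃ a b : ℚ_[p], ∃ d'' : ℕ, ∀ n : ℕ, ‖(p : ℚ_[p]) ^ d'' * coeff n
        (g - C a * (V.map PadicInt.Coe.ringHom).formalLog -
          C b * expand p hp.out.ne_zero (V.map PadicInt.Coe.ringHom).formalLog)‖ ≤ 1 := by
  set W := V.map (PadicInt.Coe.ringHom (p := p)) with hWdef
  haveI : W.IsIntegral ℤ_[p] := ⟨⟨V, rfl⟩⟩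
  have hp0 : (p : ℚ_[p]) ≠ 0 := by exact_mod_cast hp.out.ne_zero
  intro g hg0 hd hd'
  obtain ⟨k, h, h0, hint, hℓh⟩ := hW1 g hg0 hd hd'
  obtain ⟨d', hcob⟩ := hd'
  -- integral model `H` of `h`; `H̄ ∈ End(F̄)`
  obtain ⟨H, hH⟩ := isPadicInt_iff_exists_powerSeries_map.mp hint
  have hH0 : constantCoeff H = 0 := by
    apply (PadicInt.coe_eq_zero).mp
    have e := congrArg constantCoeff hH
    rw [← coeff_zero_eq_constantCoeff_apply, coeff_map, coeff_zero_eq_constantCoeff_apply] at e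
    rw [← h0]; exact e
  have hEnd := map_toZMod_subst_formalGroupLaw V hp2 hH0 (hH.symm ▸ hℓh) hcob
  obtain ⟨A, B, a, b, gJ, hg0J, hlim, hlev⟩ := hDig H hH0 hEnd
  -- the limit lemma applied to `Φ = pᵏ g = log h`
  have hℓ := W.norm_natCast_mul_coeff_formalLog_le
  have hℓ0 : constantCoeff W.formalLog = 0 := W.constantCoeff_formalLog
  have hmain : IsPadicInt (C ((p : ℚ_[p]) ^ k) * g - C (A : ℚ_[p]) * W.formalLog -
      C (B : ℚ_[p]) * expand p hp.out.ne_zero W.formalLog) := by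
    refine isPadicInt_sub_of_digits hℓ hℓ0 (a := fun J => ((a J : ℕ) : ℚ_[p])) (b := fun J => ((b J : ℕ) : ℚ_[p]))
      (fun J => ?_) (fun J => ?_) (fun J => ?_)
    · have := (hlim J).1; rwa [PadicInt.norm_def, PadicInt.coe_sub, PadicInt.coe_natCast] at this
    · have := (hlim J).2; rwa [PadicInt.norm_def, PadicInt.coe_sub, PadicInt.coe_natCast] at this
    · -- lift the level `J` to `ℤ_p` and compare logarithms modulo `p`
      obtain ⟨G₀, hG₀0, hG₀⟩ := exists_lift_eq (gJ J) (hg0J J)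
      set G := G₀.map (PadicInt.Coe.ringHom (p := p)) with hGdef
      have hG0 : constantCoeff G = 0 := by
        rw [hGdef, ← coeff_zero_eq_constantCoeff_apply, coeff_map, coeff_zero_eq_constantCoeff_apply, hG₀0, map_zero]
      have hGint : IsPadicInt G := isPadicInt_map G₀
      refine ⟨G, hGint, hG0, ?_⟩
      set K₀ : ℤ_[p]⟦X⟧ := MvPowerSeries.subst ![MvPowerSeries.subst ![V.formalMul (a J),
          expand p hp.out.ne_zero (V.formalMul (b J))] V.formalGroupLaw, (V.formalMul (p ^ J)).subst G₀] V.formalGroupLaw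
        with hK₀
      have hK₀bar : K₀.map PadicInt.toZMod = H.map PadicInt.toZMod := by
        rw [hK₀, map_level V PadicInt.toZMod (a J) (b J) (p ^ J) hG₀0, hG₀, ← hlev J]
      set h₁ := K₀.map (PadicInt.Coe.ringHom (p := p)) with hh₁
      have hK₀0 : constantCoeff K₀ = 0 := by
        rw [hK₀]
        exact MvPowerSeries.constantCoeff_subst_eq_zero
          (hasSubst_pair (constantCoeff_inner V (a J) (b J)) (constantCoeff_formalMul_subst V (p ^ J) hG₀0))
          (constantCoeff_pair (constantCoeff_inner V (a J) (b J)) (constantCoeff_formalMul_subst V (p ^ J) hG₀0))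
          V.constantCoeff_formalGroupLaw
      have h₁0 : constantCoeff h₁ = 0 := by
        rw [hh₁, ← coeff_zero_eq_constantCoeff_apply, coeff_map, coeff_zero_eq_constantCoeff_apply, hK₀0, map_zero]
      have hint₁ : IsPadicInt h₁ := isPadicInt_map K₀
      have hc : IsPadicInt (C (p : ℚ_[p])⁻¹ * (h - h₁)) := by
        have hbar : (H - K₀).map (PadicInt.toZMod (p := p)) = 0 := by rw [map_sub, hK₀bar, sub_self]
        have := FormalLogDivisibility.isPadicInt_inv_mul_of_map_toZMod_eq_zero (σ := Unit) (H - K₀) hbar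
        rw [map_sub] at this
        rw [← hH]
        exact this
      have hlog := isPadicInt_inv_mul_formalLog_subst_sub W h0 hint h₁0 hint₁ hc
      have hh₁W : h₁ = MvPowerSeries.subst ![MvPowerSeries.subst ![W.formalMul (a J),
          expand p hp.out.ne_zero (W.formalMul (b J))] W.formalGroupLaw, (W.formalMul (p ^ J)).subst G] W.formalGroupLaw := by
        rw [hh₁, hK₀, map_level V PadicInt.Coe.ringHom (a J) (b J) (p ^ J) hG₀0]
      rw [hℓh, hh₁W, formalLog_subst_level W (a J) (b J) (p ^ J) hG0, Nat.cast_pow] at hlog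
      -- drop the factor `p⁻¹`
      rw [isPadicInt_iff_coeff] at hlog ⊢
      intro n
      have hn := hlog n
      rw [coeff_C_mul, norm_inv_mul_le_one_iff] at hn
      have e : coeff n (C ((p : ℚ_[p]) ^ k) * g - C ((a J : ℕ) : ℚ_[p]) * W.formalLog -
          C ((b J : ℕ) : ℚ_[p]) * expand p hp.out.ne_zero W.formalLog - C ((p : ℚ_[p]) ^ J) * W.formalLog.subst G) =
          coeff n (C ((p : ℚ_[p]) ^ k) * g - (C ((a J : ℕ) : ℚ_[p]) * W.formalLog +
            C ((b J : ℕ) : ℚ_[p]) * expand p hp.out.ne_zero W.formalLog + C ((p : ℚ_[p]) ^ J) * W.formalLog.subst G)) := by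
        simp only [map_sub, map_add]; ring
      rw [e]
      exact hn.trans (inv_le_one_of_one_le₀ (by exact_mod_cast hp.out.one_le))
  -- divide by `pᵏ`
  refine ⟨(A : ℚ_[p]) * ((p : ℚ_[p]) ^ k)⁻¹, (B : ℚ_[p]) * ((p : ℚ_[p]) ^ k)⁻¹, k, fun n => ?_⟩
  have hpk0 : (p : ℚ_[p]) ^ k ≠ 0 := pow_ne_zero _ hp0
  have e : (p : ℚ_[p]) ^ k * coeff n (g - C ((A : ℚ_[p]) * ((p : ℚ_[p]) ^ k)⁻¹) * W.formalLog -
      C ((B : ℚ_[p]) * ((p : ℚ_[p]) ^ k)⁻¹) * expand p hp.out.ne_zero W.formalLog) =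
      coeff n (C ((p : ℚ_[p]) ^ k) * g - C (A : ℚ_[p]) * W.formalLog -
        C (B : ℚ_[p]) * expand p hp.out.ne_zero W.formalLog) := by
    simp only [map_sub, coeff_C_mul]
    field_simp
  rw [e]
  exact (isPadicInt_iff_coeff.mp hmain) n

end Bridge

end Summit.BirchSwinnertonDyer.BirchSwinnertonDyer.Theorems.PadicDigitLimit

end
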